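import Summits.ResolutionOfSingularities.ResolutionOfSingularities.Theorems.HomologicalConductorNoZenoBirthDefs
import Literature.AlgebraicGeometry.Resolution.PrimeDivisors
import Literature.AlgebraicGeometry.Resolution.Temkin2013Curves
import Literature.AlgebraicGeometry.Resolution.CompositeValuations
import Literature.AlgebraicGeometry.Resolution.TranscendenceDefect
import HarnessLib

/-!
# Crux `NoZeno` (stmt-ResolutionOfSingularities-16483), line `birth` (v4) — stub `stub_dim2ResidualACC`

Route `ResolutionOfSingularities/HomologicalConductor`, crux
`Summit.ResolutionOfSingularities.ResolutionOfSingularities.Theses.HomologicalConductor.NoZeno`.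
Registered stub of the line `birth` (skeleton v4), pure valuation theory:

  for `K/k` finitely generated of transcendence degree `2` and valuation rings `O < O₁ < K`
  with `k ⊆ O`, the ring `O` has no infinite strictly ascending chain of principal ideals
  generated by `O₁`-units: every sequence `zₙ ∈ O ∖ 0` with `zₙ⁻¹ ∈ O₁` and `zₙ · zₙ₊₁⁻¹ ∈ O`
  has some `n` with `zₙ₊₁ · zₙ⁻¹ ∈ O`.

Proof (Zariski–Samuel II, Ch. VI §14, Thm. 31, applied twice). The residual valuation ring
`Ō = O/𝔪_{O₁}` of `κ(O₁)` (`residueValuationSubring`, `CompositeValuations.lean`) is `≠ κ(O₁)`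
(as `O ≠ O₁`) and contains `k`; valuation rings being integrally closed, `κ(O₁)/k` is not
algebraic, so `F(O₁) ≥ 1`, and with `E(O₁) ≥ 1` (`one_le_ratRank_of_ne_top`) and Abhyankar's
inequality `E + F ≤ 2` (`ratRank_add_residueTrdeg_le_trdeg`) the coarsening `O₁` is a prime
divisor: `F(O₁) + 1 = tr.deg`. Hence `κ(O₁)/k` is finitely generated (`residueField_fg_of_residueTrdeg`)
of transcendence degree `1`, and the proper valuation ring `Ō ⊇ k` of it is again a prime divisor
(`residueTrdeg_add_one_eq_of_trdeg_le_one`), i.e. a discrete valuation ring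
(`isDiscreteValuationRing_of_residueTrdeg`), in particular noetherian. The `zₙ` are units of
`O₁`, and for `O₁`-units `x, y` one has `y · x⁻¹ ∈ O ↔ ȳ · x̄⁻¹ ∈ Ō`
(`residue_mem_residueValuationSubring_iff`); so the principal ideals `(z̄ₙ)` of `Ō` ascend and
stabilise, which transfers back to `zₙ₊₁ · zₙ⁻¹ ∈ O`.
-/

noncomputable section

-- single-problem summit: the doubled namespace component `ResolutionOfSingularities` is forced
set_option linter.dupNamespace false

namespace Summit.ResolutionOfSingularities.ResolutionOfSingularities.Theorems.NoZeno.Birth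

open IsLocalRing Cardinal Literature.AlgebraicGeometry.Resolution

/-! ## Two valuation-theoretic helpers -/

/-- A valuation ring of `L` containing the field `k` contains every element of `L` algebraic over
`k` (valuation rings are integrally closed in their fraction field). [folklore] -/
theorem mem_valuationSubring_of_isAlgebraic {k L : Type} [Field k] [Field L] [Algebra k L]
    (W : ValuationSubring L) (hkW : ∀ c : k, algebraMap k L c ∈ W) {x : L}
    (hx : IsAlgebraic k x) : x ∈ W := by
  letI : Algebra k W := algebraOfMem k W hkW
  haveI : IsScalarTower k W L := isScalarTower_algebraOfMem k W hkW
  have hxW : IsIntegral W x := hx.isIntegral.tower_top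
  obtain ⟨y, hy⟩ := IsIntegrallyClosed.algebraMap_eq_of_integral hxW
  rw [← hy]
  exact y.2

/-- A field `L ⊇ k` admitting a PROPER valuation ring containing `k` is transcendental over `k`:
`1 ≤ tr.deg_k L` (an algebraic `L` would lie in the integrally closed valuation ring).
[folklore] -/
theorem one_le_trdeg_of_valuationSubring_ne_top {k L : Type} [Field k] [Field L] [Algebra k L]
    (W : ValuationSubring L) (hkW : ∀ c : k, algebraMap k L c ∈ W) (hW : W ≠ ⊤) :
    1 ≤ Algebra.trdeg k L := by
  haveI : Algebra.Transcendental k L := by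
    rw [Algebra.transcendental_iff_not_isAlgebraic]
    intro halg
    apply hW
    rw [eq_top_iff]
    intro x _
    exact mem_valuationSubring_of_isAlgebraic W hkW (halg.isAlgebraic x)
  exact Cardinal.one_le_iff_pos.mpr (trdeg_pos k L)

/-! ## The registered stub -/

/-- **STUB `stub_dim2ResidualACC` (line `birth` of crux `NoZeno`, v4).** For `K/k` finitely
generated of transcendence degree `2` and valuation rings `O < O₁ < K` with `k ⊆ O`, the ring `O`
has no infinite strictly ascending chain of principal ideals generated by `O₁`-units: every
sequence `zₙ ∈ O ∖ 0` with `zₙ⁻¹ ∈ O₁` and `zₙ · zₙ₊₁⁻¹ ∈ O` has some `n` with `zₙ₊₁ · zₙ⁻¹ ∈ O`.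
Proof: the residual valuation ring `Ō = O/𝔪_{O₁}` of `κ(O₁)` is proper (`O ≠ O₁`) and contains
`k`, so `κ(O₁)/k` is not algebraic and `F(O₁) ≥ 1`; with `E(O₁) ≥ 1` and Abhyankar's inequality
`O₁` is a prime divisor, `κ(O₁)/k` is a function field of one variable, and its proper valuation
ring `Ō ⊇ k` is a prime divisor of it, hence a discrete valuation ring (Thm. 31 twice). For
`O₁`-units `x, y` one has `y · x⁻¹ ∈ O ↔ ȳ · x̄⁻¹ ∈ Ō`, so the ascending chain of principal
ideals `(z̄ₙ)` of the noetherian `Ō` stabilises, which is the claim.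
[cite: ZariskiSamuel1960, Ch. VI §14, Thm. 31] -/
theorem stub_dim2ResidualACC (k K : Type) [Field k] [Field K] [Algebra k K] (O : ValuationSubring K)
    (hk : ∀ c : k, algebraMap k K c ∈ O) (hKfg : (⊤ : IntermediateField k K).FG)
    (htr : Algebra.trdeg k K = 2) (O₁ : ValuationSubring K) (hlt : O < O₁) (hne : O₁ ≠ ⊤)
    (z : ℕ → K) (hz : ∀ n : ℕ, z n ∈ O ∧ z n ≠ 0 ∧ (z n)⁻¹ ∈ O₁)
    (hle : ∀ n : ℕ, z n * (z (n + 1))⁻¹ ∈ O) : ∃ n : ℕ, z (n + 1) * (z n)⁻¹ ∈ O := by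
  have h : O ≤ O₁ := hlt.le
  have hk₁ : ∀ c : k, algebraMap k K c ∈ O₁ := fun c => h (hk c)
  letI : Algebra k O₁ := algebraOfMem k O₁ hk₁
  haveI : IsScalarTower k O₁ K := isScalarTower_algebraOfMem k O₁ hk₁
  -- (1) the residual valuation ring `Ō = O/𝔪_{O₁}` of `κ(O₁)`: proper, containing `k`
  set Ō : ValuationSubring (ResidueField O₁) := residueValuationSubring O O₁ h with hŌ
  have hŌne : Ō ≠ ⊤ := by
    obtain ⟨y, hy₁, hyO⟩ := SetLike.exists_of_lt hlt
    intro htop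
    have hy : residue O₁ ⟨y, hy₁⟩ ∈ Ō := htop ▸ ValuationSubring.mem_top _
    exact hyO ((residue_mem_residueValuationSubring_iff O O₁ h ⟨y, hy₁⟩).mp hy)
  have hkbar : ∀ c : k, algebraMap k (ResidueField O₁) c ∈ Ō := by
    intro c
    rw [IsScalarTower.algebraMap_apply k O₁ (ResidueField O₁), ResidueField.algebraMap_eq,
      hŌ, residue_mem_residueValuationSubring_iff]
    exact hk c
  -- (2) `O₁` is a prime divisor: `F(O₁) = 1 = tr.deg - 1`
  have hNlt : Algebra.trdeg k K < ℵ₀ := trdeg_lt_aleph0_of_fg hKfg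
  obtain ⟨E, hE⟩ := Cardinal.lt_aleph0.mp (ratRank_lt_aleph0 O₁ hk₁ hNlt)
  obtain ⟨F, hFn⟩ := Cardinal.lt_aleph0.mp (residueTrdeg_lt_aleph0 O₁ hk₁ hNlt)
  have hF1 : F = 1 := by
    have h1 := one_le_ratRank_of_ne_top O₁ hne
    have h2 := ratRank_add_residueTrdeg_le_trdeg O₁ hk₁
    have h3 : 1 ≤ residueTrdeg k O₁ hk₁ := by
      rw [residueTrdeg_eq O₁ hk₁]
      exact one_le_trdeg_of_valuationSubring_ne_top Ō hkbar hŌne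
    rw [hE] at h1
    rw [hE, hFn, htr] at h2
    rw [hFn] at h3
    norm_cast at h1 h2 h3
    omega
  have hF : residueTrdeg k O₁ hk₁ + 1 = Algebra.trdeg k K := by
    rw [hFn, htr, hF1]
    norm_cast
  -- (3) `κ(O₁)/k` is a function field of one variable and `Ō` is a discrete valuation ring
  have hLfg : (⊤ : IntermediateField k (ResidueField O₁)).FG :=
    residueField_fg_of_residueTrdeg O₁ hk₁ hKfg hne hF
  have hL1 : Algebra.trdeg k (ResidueField O₁) ≤ 1 := by
    rw [← residueTrdeg_eq O₁ hk₁, hFn, hF1]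
    norm_cast
  have hDVR : IsDiscreteValuationRing Ō :=
    isDiscreteValuationRing_of_residueTrdeg Ō hkbar hLfg hŌne
      (residueTrdeg_add_one_eq_of_trdeg_le_one Ō hkbar hŌne hL1)
  have hNoeth : IsNoetherianRing Ō := inferInstance
  -- (4) residues of the `O₁`-units `z n`
  have hzO₁ : ∀ n, z n ∈ O₁ := fun n => h (hz n).1
  obtain ⟨zb, hzb⟩ : ∃ zb : ℕ → ResidueField O₁, ∀ n, zb n = residue O₁ ⟨z n, hzO₁ n⟩ :=
    ⟨_, fun _ => rfl⟩
  have hzb_mem : ∀ n, zb n ∈ Ō := fun n => by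
    rw [hzb, hŌ, residue_mem_residueValuationSubring_iff]
    exact (hz n).1
  have hzb0 : ∀ n, zb n ≠ 0 := fun n => by
    rw [hzb, residue_ne_zero_iff_isUnit]
    exact isUnit_of_inv_mem O₁ (hzO₁ n) (hz n).2.2 (hz n).2.1
  -- transfer of divisibility along the residue map: `z m / z n ∈ O ↔ z̄ m / z̄ n ∈ Ō`
  have key : ∀ m n : ℕ, z m * (z n)⁻¹ ∈ O ↔ zb m * (zb n)⁻¹ ∈ Ō := by
    intro m n
    have hmem : z m * (z n)⁻¹ ∈ O₁ := O₁.mul_mem _ _ (hzO₁ m) (hz n).2.2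
    have hres : residue O₁ ⟨z m * (z n)⁻¹, hmem⟩ = zb m * (zb n)⁻¹ := by
      rw [hzb, hzb, ← residue_mk_inv O₁ (hzO₁ n) (hz n).2.2 (hz n).2.1, ← map_mul]
      rfl
    rw [← hres, hŌ, residue_mem_residueValuationSubring_iff]
  -- (5) the ascending chain of principal ideals `(z̄ n)` of the noetherian ring `Ō`
  set w : ℕ → Ō := fun n => ⟨zb n, hzb_mem n⟩ with hw
  have hdvd : ∀ m n : ℕ, zb m * (zb n)⁻¹ ∈ Ō ↔ w m ∈ Ideal.span {w n} := by
    intro m n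
    rw [Ideal.mem_span_singleton']
    constructor
    · intro hq
      refine ⟨⟨zb m * (zb n)⁻¹, hq⟩, Subtype.ext ?_⟩
      show zb m * (zb n)⁻¹ * zb n = zb m
      rw [inv_mul_cancel_right₀ (hzb0 n)]
    · rintro ⟨a, ha⟩
      have ha' : (a : ResidueField O₁) * zb n = zb m := congrArg Subtype.val ha
      rw [← ha', mul_inv_cancel_right₀ (hzb0 n)]
      exact a.2
  let I : ℕ →o Ideal Ō :=
    { toFun := fun n => Ideal.span {w n}
      monotone' := monotone_nat_of_le_succ fun n => by
        rw [Ideal.span_singleton_le_iff_mem]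
        exact (hdvd n (n + 1)).mp ((key n (n + 1)).mp (hle n)) }
  obtain ⟨N, hN⟩ := (monotone_stabilizes_iff_noetherian.mpr hNoeth) I
  refine ⟨N, (key (N + 1) N).mpr ((hdvd (N + 1) N).mpr ?_)⟩
  have hmemI : w (N + 1) ∈ I (N + 1) := Ideal.mem_span_singleton_self _
  rw [← hN (N + 1) (Nat.le_succ N)] at hmemI
  exact hmemI

end Summit.ResolutionOfSingularities.ResolutionOfSingularities.Theorems.NoZeno.Birth

end
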